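import Mathlib.Combinatorics.SimpleGraph.Walk.Counting
import Mathlib.Combinatorics.SimpleGraph.Paths
import Mathlib.Combinatorics.SimpleGraph.DeleteEdges
import Mathlib.Topology.Algebra.InfiniteSum.ENNReal
import Summits.CriticalPhenomena.SAWScalingLimit.Theorems.SAWTotalPositivityBoundaryTP2Defs
import Summits.CriticalPhenomena.SAWScalingLimit.Theorems.SAWTotalPositivityBoundaryTP2Kernel
import Summits.CriticalPhenomena.SAWScalingLimit.Theorems.SAWTotalPositivityBoundaryTP2Symmetry
import Summits.CriticalPhenomena.SAWScalingLimit.Theorems.SAWTotalPositivityBoundaryTP2Avoid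
import Summits.CriticalPhenomena.SAWScalingLimit.Theorems.SAWTotalPositivityBoundaryTP2InterlaceInherit
import Summits.CriticalPhenomena.SAWScalingLimit.Theorems.SAWTotalPositivityBoundaryTP2FirstStep
import HarnessLib

/-!
# Crux `BoundaryTP2` (stmt-CriticalPhenomena-7115), line `corner-deletion-induction`: two-arm stars at a
vertex (helper file of the stub `stub_starDecomposition`)

For the fugacity-`x` self-avoiding path kernel of a simple graph `H` (`pathKernel`, `pathKernelOn`) and a
vertex `c`, write `H − c` for Mathlib's `H.deleteEdges (H.incidenceSet c)` (same vertex type, `c`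
isolated). This file proves the decompositions of the kernels at `c` used by the three-arm star
decomposition of the corner remainder (`…BoundaryTP2StarDecomposition.lean`):

* the **two-arm bijection** (`pathKernelOn_visit_eq_tsum_arms`): a self-avoiding path `s → t` of `H`
  through `c ∉ {s, t}` is `α · (a c b) · β` for a unique pair of neighbours `a, b` of `c` and unique
  vertex-disjoint self-avoiding arms `α : s → a`, `β : b → t` of `H − c`, with `|γ| = |α| + |β| + 2`; so
  the kernel of the paths through `c` is `V(s,t) = x² Σ_{a b α β} [α ⊥ β] x^{|α|} x^{|β|}`
  (`⊥` = vertex-disjoint supports). The assembling map is injective because a walk of a simple graph is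
  determined by its support (`SimpleGraph.Walk.ext_support`) and `c` is not on the arms; it is onto the
  paths through `c` by induction along the path. `pathKernelOn_visit_eq_tsum_arms'` is the same with
  the first arm reversed (`α : a → s`);
* the one-arm (first-step / last-step) decompositions `Z(c,t) = x Σ_{b ∼ c} Σ_{β : b → t in H − c} x^{|β|}`
  and `Z(s,c) = x Σ_{a ∼ c} Σ_{α : s → a in H − c} x^{|α|}` (`pathKernel_eq_tsum_firstArm`,
  `pathKernel_eq_tsum_lastArm`), from the landed `stub_pathKernel_firstStep`, `stub_pathKernelOn_avoid`
  and reversal.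

All sums are unconditional sums in `ℝ≥0∞`; no finiteness of `H` is needed; `0 ≤ x` is used only to
split `ENNReal.ofReal` of products. Everything is proved from Mathlib and the landed toolkit. [folklore]
-/

noncomputable section

namespace Summit.CriticalPhenomena.SAWScalingLimit.Theorems.BoundaryTP2

open SimpleGraph
open scoped ENNReal

/-! ## List and walk preliminaries -/

/-- Splitting `l₁ ++ c :: r₁ = l₂ ++ c :: r₂` at the occurrence of `c` following a `c`-free prefix.
[folklore] -/
private theorem append_cons_inj_of_notMem {ι : Type*} {c : ι} {l₁ l₂ r₁ r₂ : List ι}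
    (h : l₁ ++ c :: r₁ = l₂ ++ c :: r₂) (h₁ : c ∉ l₁) (h₂ : c ∉ l₂) : l₁ = l₂ ∧ r₁ = r₂ := by
  induction l₁ generalizing l₂ with
  | nil =>
    cases l₂ with
    | nil => simpa using h
    | cons y l₂ =>
      simp only [List.nil_append, List.cons_append, List.cons.injEq] at h
      exact absurd (List.mem_cons.2 (Or.inl h.1)) h₂
  | cons z l₁ ih =>
    cases l₂ with
    | nil =>
      simp only [List.nil_append, List.cons_append, List.cons.injEq] at h
      exact absurd (List.mem_cons.2 (Or.inl h.1.symm)) h₁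
    | cons y l₂ =>
      simp only [List.cons_append, List.cons.injEq] at h
      rw [List.mem_cons, not_or] at h₁ h₂
      obtain ⟨h₃, h₄⟩ := ih h.2 h₁.2 h₂.2
      exact ⟨by rw [h.1, h₃], h₄⟩

/-- Walks with the same support have the same endpoints. [folklore] -/
private theorem ends_eq_of_support_eq {V : Type*} {G G' : SimpleGraph V} {u v u' v' : V}
    {p : G.Walk u v} {q : G'.Walk u' v'} (h : p.support = q.support) : u = u' ∧ v = v' := by
  refine ⟨?_, ?_⟩
  · have h₁ := h
    rw [← p.cons_tail_support, ← q.cons_tail_support] at h₁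
    exact List.head_eq_of_cons_eq h₁
  · have h₁ := congrArg List.reverse h
    rw [← Walk.support_reverse, ← Walk.support_reverse, ← p.reverse.cons_tail_support,
      ← q.reverse.cons_tail_support] at h₁
    exact List.head_eq_of_cons_eq h₁

/-- Members of the neighbour set of `c` are adjacent to `c`. [folklore] -/
private theorem adj_of_mem_neighborSet {V : Type*} {H : SimpleGraph V} {c : V} (a : H.neighborSet c) :
    H.Adj c a := a.2

/-- An edge of `H` with both endpoints different from `c` is an edge of `H − c`. [folklore] -/
private theorem adj_deleteEdges_incidenceSet {V : Type*} {H : SimpleGraph V} {c u v : V}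
    (h : H.Adj u v) (hu : u ≠ c) (hv : v ≠ c) : (H.deleteEdges (H.incidenceSet c)).Adj u v := by
  rw [deleteEdges_adj, mk'_mem_incidenceSet_iff]
  exact ⟨h, fun h' => h'.2.elim (fun e => hu e.symm) fun e => hv e.symm⟩

/-! ## Assembling a two-arm star at `c` into a walk of `H` -/

/-- The vertices of the assembled walk `α · (a c b) · β`. [folklore] -/
private theorem support_arms {V : Type*} {H : SimpleGraph V} {c s t a b : V}
    (hle : H.deleteEdges (H.incidenceSet c) ≤ H)
    (α : (H.deleteEdges (H.incidenceSet c)).Walk s a) (β : (H.deleteEdges (H.incidenceSet c)).Walk b t)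
    (hac : H.Adj a c) (hcb : H.Adj c b) :
    ((α.mapLe hle).append (Walk.cons hac (Walk.cons hcb (β.mapLe hle)))).support =
      α.support ++ c :: β.support := by
  rw [Walk.support_append, Walk.support_mapLe_eq_support, Walk.support_cons, Walk.support_cons,
    Walk.support_mapLe_eq_support, List.tail_cons]

/-- The corner `c` lies on the assembled walk `α · (a c b) · β`. [folklore] -/
private theorem mem_support_arms {V : Type*} {H : SimpleGraph V} {c s t a b : V}
    (hle : H.deleteEdges (H.incidenceSet c) ≤ H)
    (α : (H.deleteEdges (H.incidenceSet c)).Walk s a) (β : (H.deleteEdges (H.incidenceSet c)).Walk b t)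
    (hac : H.Adj a c) (hcb : H.Adj c b) :
    c ∈ ((α.mapLe hle).append (Walk.cons hac (Walk.cons hcb (β.mapLe hle)))).support := by
  rw [support_arms]
  exact List.mem_append_right _ List.mem_cons_self

/-- The length of the assembled walk `α · (a c b) · β` is `|α| + |β| + 2`. [folklore] -/
private theorem length_arms {V : Type*} {H : SimpleGraph V} {c s t a b : V}
    (hle : H.deleteEdges (H.incidenceSet c) ≤ H)
    (α : (H.deleteEdges (H.incidenceSet c)).Walk s a) (β : (H.deleteEdges (H.incidenceSet c)).Walk b t)
    (hac : H.Adj a c) (hcb : H.Adj c b) :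
    ((α.mapLe hle).append (Walk.cons hac (Walk.cons hcb (β.mapLe hle)))).length =
      α.length + β.length + 2 := by
  have h := ((α.mapLe hle).append (Walk.cons hac (Walk.cons hcb (β.mapLe hle)))).length_support
  rw [support_arms, List.length_append, List.length_cons, Walk.length_support,
    Walk.length_support] at h
  omega

/-- The assembled walk `α · (a c b) · β` is self-avoiding iff the arms are self-avoiding and
vertex-disjoint (the arms live in `H − c`, so they avoid `c`). [folklore] -/
private theorem isPath_arms_iff {V : Type*} {H : SimpleGraph V} {c s t a b : V}
    (hle : H.deleteEdges (H.incidenceSet c) ≤ H)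
    (α : (H.deleteEdges (H.incidenceSet c)).Walk s a) (β : (H.deleteEdges (H.incidenceSet c)).Walk b t)
    (hac : H.Adj a c) (hcb : H.Adj c b) (hα : c ∉ α.support) (hβ : c ∉ β.support) :
    ((α.mapLe hle).append (Walk.cons hac (Walk.cons hcb (β.mapLe hle)))).IsPath ↔
      α.IsPath ∧ β.IsPath ∧ List.Disjoint α.support β.support := by
  rw [Walk.isPath_def, Walk.isPath_def, Walk.isPath_def, support_arms, List.nodup_append',
    List.nodup_cons, List.disjoint_cons_right]
  exact ⟨fun h => ⟨h.1, h.2.1.2, h.2.2.2⟩, fun h => ⟨h.1, ⟨hβ, h.2.1⟩, hα, h.2.2⟩⟩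

/-- **Splitting a self-avoiding path at an interior vertex `c`.** A self-avoiding path `s → t` of `H`
through `c ∉ {s, t}` is the assembled walk `α · (a c b) · β` of two arms `α : s → a`, `β : b → t` of
`H − c` at neighbours `a, b` of `c` (induction along the path). [folklore] -/
private theorem exists_arms {V : Type*} {H : SimpleGraph V} {c s t : V}
    (hle : H.deleteEdges (H.incidenceSet c) ≤ H) (γ : H.Walk s t) (hp : γ.IsPath)
    (hc : c ∈ γ.support) (hs : s ≠ c) (ht : t ≠ c) :
    ∃ (a b : V) (hca : H.Adj c a) (hcb : H.Adj c b)
      (α : (H.deleteEdges (H.incidenceSet c)).Walk s a)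
      (β : (H.deleteEdges (H.incidenceSet c)).Walk b t),
      (α.mapLe hle).append (Walk.cons hca.symm (Walk.cons hcb (β.mapLe hle))) = γ := by
  induction γ with
  | nil =>
    rw [Walk.support_nil, List.mem_singleton] at hc
    exact absurd hc.symm hs
  | @cons u v w h q ih =>
    rw [Walk.cons_isPath_iff] at hp
    rw [Walk.support_cons, List.mem_cons] at hc
    have hcq : c ∈ q.support := hc.resolve_left fun h' => hs h'.symm
    by_cases hvc : v = c
    · subst hvc
      cases q with
      | nil => exact absurd rfl ht
      | @cons _ b _ h₂ r =>
        rw [Walk.cons_isPath_iff] at hp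
        refine ⟨u, b, h.symm, h₂, Walk.nil,
          r.toDeleteEdges _ (fun e he hinc => hp.1.2 (Walk.mem_support_of_mem_edges he hinc.2)), ?_⟩
        change Walk.cons h (Walk.cons h₂ (Walk.map (Hom.ofLE hle) (r.toDeleteEdges _ _))) = _
        rw [Walk.map_toDeleteEdges_eq]
        rfl
    · obtain ⟨a, b, hca, hcb, α, β, hq⟩ := ih hp.1 hcq hvc ht
      refine ⟨a, b, hca, hcb, Walk.cons (adj_deleteEdges_incidenceSet h hs hvc) α, β, ?_⟩
      rw [← hq]
      rfl

/-- **The assembling map is injective**: a walk of a simple graph is determined by its support, and the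
support `α ++ c :: β` of the assembled walk determines the arms since `c` is not on `α`. [folklore] -/
private theorem arms_injective {V : Type*} {H : SimpleGraph V} {c s t : V}
    (hle : H.deleteEdges (H.incidenceSet c) ≤ H) (hs : s ≠ c) :
    Function.Injective fun p : (Σ a : H.neighborSet c, Σ b : H.neighborSet c,
        (H.deleteEdges (H.incidenceSet c)).Path s a × (H.deleteEdges (H.incidenceSet c)).Path b t) =>
      (p.2.2.1.1.mapLe hle).append (Walk.cons (adj_of_mem_neighborSet p.1).symm
        (Walk.cons (adj_of_mem_neighborSet p.2.1) (p.2.2.2.1.mapLe hle))) := by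
  rintro ⟨a, b, α, β⟩ ⟨a', b', α', β'⟩ h
  have hw := congrArg Walk.support h
  simp only [support_arms] at hw
  obtain ⟨h₁, h₂⟩ := append_cons_inj_of_notMem hw
    (notMem_support_of_walk_deleteEdges_incidenceSet α.1 hs (adj_of_mem_neighborSet a).ne.symm)
    (notMem_support_of_walk_deleteEdges_incidenceSet α'.1 hs (adj_of_mem_neighborSet a').ne.symm)
  obtain ⟨-, ha⟩ := ends_eq_of_support_eq h₁
  obtain ⟨hb, -⟩ := ends_eq_of_support_eq h₂
  obtain rfl : a = a' := Subtype.ext ha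
  obtain rfl : b = b' := Subtype.ext hb
  obtain rfl : α = α' := Subtype.ext (Walk.ext_support h₁)
  obtain rfl : β = β' := Subtype.ext (Walk.ext_support h₂)
  rfl

open Classical in
/-- The weight, among self-avoiding walks through `c`, of the walk assembled from a star
`(a, b, α, β)`: `x² · x^{|α|} x^{|β|}` if the arms are vertex-disjoint, `0` otherwise. [folklore] -/
private theorem indicator_arms {V : Type*} {H : SimpleGraph V} (x : ℝ) (hx : 0 ≤ x) {c s t : V}
    (hle : H.deleteEdges (H.incidenceSet c) ≤ H) (hs : s ≠ c) (ht : t ≠ c)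
    (p : Σ a : H.neighborSet c, Σ b : H.neighborSet c,
      (H.deleteEdges (H.incidenceSet c)).Path s a × (H.deleteEdges (H.incidenceSet c)).Path b t) :
    {w : H.Walk s t | w.IsPath}.indicator
        ({w : H.Walk s t | c ∈ w.support}.indicator fun w => ENNReal.ofReal (x ^ w.length))
        ((p.2.2.1.1.mapLe hle).append (Walk.cons (adj_of_mem_neighborSet p.1).symm
          (Walk.cons (adj_of_mem_neighborSet p.2.1) (p.2.2.2.1.mapLe hle)))) =
      ENNReal.ofReal x ^ 2 *
        if List.Disjoint p.2.2.1.1.support p.2.2.2.1.support then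
          ENNReal.ofReal (x ^ p.2.2.1.1.length) * ENNReal.ofReal (x ^ p.2.2.2.1.length)
        else 0 := by
  obtain ⟨a, b, α, β⟩ := p
  have hα : c ∉ α.1.support :=
    notMem_support_of_walk_deleteEdges_incidenceSet α.1 hs (adj_of_mem_neighborSet a).ne.symm
  have hβ : c ∉ β.1.support :=
    notMem_support_of_walk_deleteEdges_incidenceSet β.1 (adj_of_mem_neighborSet b).ne.symm ht
  have hiff := isPath_arms_iff hle α.1 β.1 (adj_of_mem_neighborSet a).symm (adj_of_mem_neighborSet b)
    hα hβ
  by_cases hd : List.Disjoint α.1.support β.1.support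
  · rw [if_pos hd, Set.indicator_of_mem (s := {w : H.Walk s t | w.IsPath}) (hiff.2 ⟨α.2, β.2, hd⟩),
      Set.indicator_of_mem (s := {w : H.Walk s t | c ∈ w.support}) (mem_support_arms hle _ _ _ _)]
    dsimp only
    rw [length_arms, ENNReal.ofReal_pow hx, ENNReal.ofReal_pow hx, ENNReal.ofReal_pow hx]
    ring
  · rw [if_neg hd, mul_zero]
    exact Set.indicator_of_notMem (s := {w : H.Walk s t | w.IsPath}) (fun hP => hd (hiff.1 hP).2.2) _

/-! ## The two-arm decomposition of the kernel of the paths through a vertex -/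

open Classical in
/-- **Paths through `c` are two-arm stars at `c`.** For `s ≠ c`, `t ≠ c` and `0 ≤ x`,
`Σ_{γ : s → t self-avoiding, c ∈ γ} x^{|γ|} = x² Σ_{a, b ∼ c} Σ_{α : s → a} Σ_{β : b → t} [α ⊥ β] x^{|α|} x^{|β|}`,
the arms `α, β` ranging over the self-avoiding paths of `H − c = H.deleteEdges (H.incidenceSet c)` and
`⊥` meaning vertex-disjoint supports: `γ ↦ (γ` before `c` minus its last edge`,` `γ` after `c` minus its
first edge`)` is a bijection onto the disjoint stars, with `|γ| = |α| + |β| + 2`. All sums are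
unconditional sums in `ℝ≥0∞`. [folklore] -/
theorem pathKernelOn_visit_eq_tsum_arms {V : Type*} (H : SimpleGraph V) (x : ℝ) (hx : 0 ≤ x)
    (s t c : V) (hs : s ≠ c) (ht : t ≠ c) :
    pathKernelOn H x s t {γ | c ∈ γ.1.support} =
      ENNReal.ofReal x ^ 2 *
        ∑' (a : H.neighborSet c) (b : H.neighborSet c)
          (α : (H.deleteEdges (H.incidenceSet c)).Path s a)
          (β : (H.deleteEdges (H.incidenceSet c)).Path b t),
          if List.Disjoint α.1.support β.1.support then
            ENNReal.ofReal (x ^ α.1.length) * ENNReal.ofReal (x ^ β.1.length) else 0 := by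
  have hle : H.deleteEdges (H.incidenceSet c) ≤ H := deleteEdges_le _
  -- as a sum over all walks `s → t` of the weights of the self-avoiding ones through `c`
  have step₁ : pathKernelOn H x s t {γ | c ∈ γ.1.support} =
      ∑' w : H.Walk s t, {w : H.Walk s t | w.IsPath}.indicator
        ({w : H.Walk s t | c ∈ w.support}.indicator fun w => ENNReal.ofReal (x ^ w.length)) w := by
    rw [pathKernelOn]
    refine Eq.trans (tsum_congr fun γ => ?_) (tsum_subtype _ _)
    by_cases hc : c ∈ γ.1.support
    · exact (Set.indicator_of_mem (s := {γ : H.Path s t | c ∈ γ.1.support}) hc _).trans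
        (Set.indicator_of_mem (s := {w : H.Walk s t | c ∈ w.support}) hc
          fun w : H.Walk s t => ENNReal.ofReal (x ^ w.length)).symm
    · exact (Set.indicator_of_notMem (s := {γ : H.Path s t | c ∈ γ.1.support}) hc _).trans
        (Set.indicator_of_notMem (s := {w : H.Walk s t | c ∈ w.support}) hc
          fun w : H.Walk s t => ENNReal.ofReal (x ^ w.length)).symm
  rw [step₁]
  -- reindex by stars along the (injective) assembling map, whose range contains the support
  refine ((arms_injective (t := t) hle hs).tsum_eq ?_).symm.trans ?_
  · intro w hw
    rw [Function.mem_support] at hw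
    have hP : w.IsPath := by
      by_contra h'
      exact hw (Set.indicator_of_notMem (s := {w : H.Walk s t | w.IsPath}) h' _)
    have hc : c ∈ w.support := by
      by_contra h'
      apply hw
      rw [Set.indicator_of_mem (s := {w : H.Walk s t | w.IsPath}) hP]
      exact Set.indicator_of_notMem (s := {w : H.Walk s t | c ∈ w.support}) h' _
    obtain ⟨a, b, hca, hcb, α, β, hw'⟩ := exists_arms hle w hP hc hs ht
    have hP' := hP
    rw [← hw'] at hP'
    obtain ⟨hα, hβ, -⟩ := (isPath_arms_iff hle α β hca.symm hcb
      (notMem_support_of_walk_deleteEdges_incidenceSet α hs hca.ne.symm)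
      (notMem_support_of_walk_deleteEdges_incidenceSet β hcb.ne.symm ht)).1 hP'
    exact ⟨⟨⟨a, hca⟩, ⟨b, hcb⟩, ⟨α, hα⟩, ⟨β, hβ⟩⟩, hw'⟩
  -- evaluate the weight of each star and unfold the sum over stars
  refine (tsum_congr fun p => indicator_arms x hx hle hs ht p).trans ?_
  rw [ENNReal.tsum_mul_left]
  congr 1
  rw [ENNReal.tsum_sigma']
  refine tsum_congr fun a => ?_
  rw [ENNReal.tsum_sigma']
  refine tsum_congr fun b => ?_
  exact ENNReal.tsum_prod'

open Classical in
/-- The two-arm decomposition with the first arm reversed (`α : a → s` instead of `s → a`): path reversal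
is a length- and support-preserving bijection. [folklore] -/
theorem pathKernelOn_visit_eq_tsum_arms' {V : Type*} (H : SimpleGraph V) (x : ℝ) (hx : 0 ≤ x)
    (s t c : V) (hs : s ≠ c) (ht : t ≠ c) :
    pathKernelOn H x s t {γ | c ∈ γ.1.support} =
      ENNReal.ofReal x ^ 2 *
        ∑' (a : H.neighborSet c) (b : H.neighborSet c)
          (α : (H.deleteEdges (H.incidenceSet c)).Path a s)
          (β : (H.deleteEdges (H.incidenceSet c)).Path b t),
          if List.Disjoint α.1.support β.1.support then
            ENNReal.ofReal (x ^ α.1.length) * ENNReal.ofReal (x ^ β.1.length) else 0 := by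
  rw [pathKernelOn_visit_eq_tsum_arms H x hx s t c hs ht]
  congr 1
  refine tsum_congr fun a => tsum_congr fun b => ?_
  refine (Equiv.tsum_eq (pathReverseEquiv (H.deleteEdges (H.incidenceSet c)) (a : V) s) _).symm.trans ?_
  refine tsum_congr fun α => tsum_congr fun β => ?_
  simp only [pathReverseEquiv, Equiv.coe_fn_mk, Walk.support_reverse, List.disjoint_reverse_left,
    Walk.length_reverse]

/-! ## One-arm decompositions of `Z(c, t)` and `Z(s, c)` -/

/-- First-step form of `Z(c,t)` over the arms out of `c`: for `c ≠ t`,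
`Z(c,t) = x Σ_{b ∼ c} Σ_{β : b → t self-avoiding in H − c} x^{|β|}`. [folklore] -/
theorem pathKernel_eq_tsum_firstArm {V : Type*} (H : SimpleGraph V) (x : ℝ) (hx : 0 ≤ x) (c t : V)
    (hct : c ≠ t) :
    pathKernel H x c t = ENNReal.ofReal x *
      ∑' (b : H.neighborSet c) (β : (H.deleteEdges (H.incidenceSet c)).Path b t),
        ENNReal.ofReal (x ^ β.1.length) := by
  rw [stub_pathKernel_firstStep H x hx c t hct]
  congr 1
  refine tsum_congr fun b => ?_
  rw [stub_pathKernelOn_avoid H x b t c (adj_of_mem_neighborSet b).ne.symm hct.symm]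
  rfl

/-- Last-step form of `Z(s,c)` over the arms into `c`: for `c ≠ s`,
`Z(s,c) = x Σ_{a ∼ c} Σ_{α : s → a self-avoiding in H − c} x^{|α|}`. [folklore] -/
theorem pathKernel_eq_tsum_lastArm {V : Type*} (H : SimpleGraph V) (x : ℝ) (hx : 0 ≤ x) (s c : V)
    (hcs : c ≠ s) :
    pathKernel H x s c = ENNReal.ofReal x *
      ∑' (a : H.neighborSet c) (α : (H.deleteEdges (H.incidenceSet c)).Path s a),
        ENNReal.ofReal (x ^ α.1.length) := by
  rw [pathKernel_comm H x s c, stub_pathKernel_firstStep H x hx c s hcs]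
  congr 1
  refine tsum_congr fun a => ?_
  rw [pathKernelOn_avoid_comm H x (a : V) s c,
    stub_pathKernelOn_avoid H x s a c hcs.symm (adj_of_mem_neighborSet a).ne.symm]
  rfl

end Summit.CriticalPhenomena.SAWScalingLimit.Theorems.BoundaryTP2
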